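import Mathlib
import HarnessLib
import Summits.HubbardSuperconductivity.HubbardSuperconductivity.Theorems.KLProgrammeKLRegimeEngineFrameShiftResponse
import Summits.HubbardSuperconductivity.HubbardSuperconductivity.Theorems.KLProgrammeKLRegimeEngineCovarianceResponseFourLeg

/-!
# K3 ENGINE child (stmt-HubbardSuperconductivity-20437 `KLRegimeEngineV17F2`), stub (c) `hshift` producer «(c)-HSHIFT-4LEG»:
# the scale-`Λ` FRAME-SHIFT VALUE response of the FOUR-leg kernel at one string — linear in `frameDist`, every scale

Cell gate-hubbard-kl, seat p2 (g23); the four-leg twin of p2 g10's `covResp_norm_selfEnergy_frameShift_sub_le`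
(`…EngineFrameShiftResponse`), asked for by k3c2-p2 (g21).  With `s_i = uvSymbolCT … K_i Λ` the one-shot UV symbols of two frames,
the generic four-leg door `covResp_norm_kernel_four_sub_le` (`…EngineCovarianceResponseFourLeg`: loop `30·(Σ_p‖s₁−s₀‖)·N₆`, tree
`8·D·S·N₄` with `D` the POINTWISE symbol shift at the external labels) is fed the frame-shift symbol estimates of
`…EngineFrameShiftResponse` (`sum_norm_uvSymbolCT_sub_le`: `Σ_p ‖s₁−s₀‖ ≤ 2L²(2B₁+1)βL²(2β/Λ)·frameDist K₁ K₀`;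
`norm_uvSymbolCT_sub_le_unif`: `‖(s₁−s₀)(p)‖ ≤ 4(2B₁+1)βL²/Λ²·frameDist K₁ K₀`, NO hypothesis on the size of the frames):

* **`covResp_norm_kernel_four_frameShift_sub_le`** — under the door's hypotheses along `C^{K₀}_{>Λ} + t(C^{K₁}_{>Λ} − C^{K₀}_{>Λ})`
  (`Z_t ≠ 0`; six-leg kernels at `(X, Ā, A)` `≤ N₆`; two-leg kernels at `(X̄_i, X_i)` `≤ S`; the four-leg kernel at `X` `≤ N₄`),
  `‖[𝒢(C^{K₁}_{>Λ},V_U)]₄(X) − [𝒢(C^{K₀}_{>Λ},V_U)]₄(X)‖ ≤ 30·(2L²(2B₁+1)βL²(2β/Λ)·frameDist K₁ K₀)·N₆ + 8·(4(2B₁+1)βL²/Λ²·frameDist K₁ K₀)·S·N₄`;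
* **`covResp_norm_kernel_four_frameShift_sub_le'`** — the same factored as `(A₆·N₆ + A₄·S·N₄)·frameDist K₁ K₀`,
  `A₆ = 30·2L²(2B₁+1)βL²(2β/Λ)`, `A₄ = 8·4(2B₁+1)βL²/Λ²` (the interface announced on the cell bus, STATUS 21:1xZ 2026-08-28).

`B₁` is any bound on `|salmhoferCutoff′|` (`abs_deriv_salmhoferCutoff_le_numeral`: `2736`).  Proofs only; `N₆`, `S`, `N₄` are hypotheses;
nothing about their sizes is asserted; nothing here asserts (c), (C), K3 or superconductivity.
References: Salmhofer 1998 §3.1 Prop. 1, §4.1 [cite: Salmhofer1998].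
-/

noncomputable section

namespace Summit.HubbardSuperconductivity.HubbardSuperconductivity.Theorems.EngineV8

set_option linter.dupNamespace false -- summit = problem name (single-conjunct summit), D-0017

open Literature.MathematicalPhysics.QuantumLattice Literature.Probability.LatticeModels GrassmannAlgebra
open Summit.HubbardSuperconductivity.HubbardSuperconductivity.Theorems.KLRegimeSplit

variable {L M : ℕ} [NeZero L]

/-- **The composed scale-`Λ` frame-shift VALUE door for the four-leg kernel at one string**: with `s_i = uvSymbolCT … K_i Λ` and the
hypotheses of `covResp_norm_kernel_four_sub_le` along the interpolation (`Z_t ≠ 0`, six-leg kernels at `(X, Ā, A)` `≤ N₆`, two-leg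
kernels at `(X̄_i, X_i)` `≤ S`, the four-leg kernel at `X` `≤ N₄`):
`‖[𝒢(C^{K₁}_{>Λ},V_U)]₄(X) − [𝒢(C^{K₀}_{>Λ},V_U)]₄(X)‖ ≤ 30·(2L²(2B₁+1)βL²(2β/Λ)·frameDist K₁ K₀)·N₆ + 8·(4(2B₁+1)βL²/Λ²·frameDist K₁ K₀)·S·N₄`
— linear in `frameDist K₁ K₀`, NO hypothesis on the size of the frames (every scale). -/
theorem covResp_norm_kernel_four_frameShift_sub_le {B₁ : ℝ} (hB : ∀ y, |deriv salmhoferCutoff y| ≤ B₁) {β : ℝ} (hβ : 0 < β) {Λ : ℝ}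
    (hΛ : 0 < Λ) (μ U : ℝ) (K₀ K₁ : TrigPolyC4v) {s₀ s₁ : FreqMomentum L M × Fin 2 → ℂ} (hs₀ : s₀ = uvSymbolCT L M β μ K₀ Λ)
    (hs₁ : s₁ = uvSymbolCT L M β μ K₁ Λ) (X : Fin 4 → HubbardFieldIdx L M)
    (hZ : ∀ t ∈ Set.Icc (0 : ℝ) 1, effPartitionFn ℂ (normalCovariance L M s₀ + ((t : ℂ)) • (normalCovariance L M s₁ - normalCovariance L M s₀))
      (hubbardInteraction L M β U) ≠ 0)
    {N₆ S N₄ : ℝ}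
    (hN6 : ∀ t ∈ Set.Icc (0 : ℝ) 1, ∀ A : HubbardFieldIdx L M,
      ‖kernel ℂ (effAction ℂ (normalCovariance L M s₀ + ((t : ℂ)) • (normalCovariance L M s₁ - normalCovariance L M s₀))
        (hubbardInteraction L M β U)) 6 (Fin.snoc (Fin.snoc X (A.1, 1 - A.2) : Fin 5 → HubbardFieldIdx L M) A)‖ ≤ N₆)
    (hS : ∀ t ∈ Set.Icc (0 : ℝ) 1, ∀ i : Fin 4,
      ‖kernel ℂ (effAction ℂ (normalCovariance L M s₀ + ((t : ℂ)) • (normalCovariance L M s₁ - normalCovariance L M s₀))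
        (hubbardInteraction L M β U)) 2 ![(((X i).1, 1 - (X i).2) : HubbardFieldIdx L M), X i]‖ ≤ S)
    (hN4 : ∀ t ∈ Set.Icc (0 : ℝ) 1,
      ‖kernel ℂ (effAction ℂ (normalCovariance L M s₀ + ((t : ℂ)) • (normalCovariance L M s₁ - normalCovariance L M s₀))
        (hubbardInteraction L M β U)) 4 X‖ ≤ N₄) :
    ‖kernel ℂ (effAction ℂ (normalCovariance L M s₁) (hubbardInteraction L M β U)) 4 X -
        kernel ℂ (effAction ℂ (normalCovariance L M s₀) (hubbardInteraction L M β U)) 4 X‖ ≤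
      30 * (2 * (L : ℝ) ^ 2 * ((2 * B₁ + 1) * (β * (L : ℝ) ^ 2)) * (2 * β / Λ) * frameDist K₁ K₀) * N₆ +
        8 * (4 * ((2 * B₁ + 1) * (β * (L : ℝ) ^ 2)) / Λ ^ 2 * frameDist K₁ K₀) * S * N₄ := by
  have hD : ∀ i : Fin 4, ‖s₁ (X i).1 - s₀ (X i).1‖ ≤ 4 * ((2 * B₁ + 1) * (β * (L : ℝ) ^ 2)) / Λ ^ 2 * frameDist K₁ K₀ := by
    intro i
    subst hs₀ hs₁
    exact norm_uvSymbolCT_sub_le_unif hB hβ hΛ μ K₁ K₀ (X i).1.1.1 (X i).1.1.2 (X i).1.2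
  have h := covResp_norm_kernel_four_sub_le s₀ s₁ β U X hZ hN6 hS hN4 hD
  refine h.trans (add_le_add ?_ le_rfl)
  have hN60 : 0 ≤ N₆ := (norm_nonneg _).trans (hN6 0 ⟨le_rfl, zero_le_one⟩ (X 0))
  have h1 : ∑ p, ‖s₁ p - s₀ p‖ ≤ 2 * (L : ℝ) ^ 2 * ((2 * B₁ + 1) * (β * (L : ℝ) ^ 2)) * (2 * β / Λ) * frameDist K₁ K₀ := by
    subst hs₀ hs₁
    exact sum_norm_uvSymbolCT_sub_le hB hβ hΛ μ K₁ K₀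
  exact mul_le_mul_of_nonneg_right (mul_le_mul_of_nonneg_left h1 (by norm_num)) hN60

/-- **The same, factored**: `‖[𝒢(C^{K₁}_{>Λ},V_U)]₄(X) − [𝒢(C^{K₀}_{>Λ},V_U)]₄(X)‖ ≤ (A₆·N₆ + A₄·S·N₄)·frameDist K₁ K₀` with
`A₆ = 30·(2L²(2B₁+1)βL²(2β/Λ))`, `A₄ = 8·(4(2B₁+1)βL²/Λ²)`. -/
theorem covResp_norm_kernel_four_frameShift_sub_le' {B₁ : ℝ} (hB : ∀ y, |deriv salmhoferCutoff y| ≤ B₁) {β : ℝ} (hβ : 0 < β) {Λ : ℝ}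
    (hΛ : 0 < Λ) (μ U : ℝ) (K₀ K₁ : TrigPolyC4v) {s₀ s₁ : FreqMomentum L M × Fin 2 → ℂ} (hs₀ : s₀ = uvSymbolCT L M β μ K₀ Λ)
    (hs₁ : s₁ = uvSymbolCT L M β μ K₁ Λ) (X : Fin 4 → HubbardFieldIdx L M)
    (hZ : ∀ t ∈ Set.Icc (0 : ℝ) 1, effPartitionFn ℂ (normalCovariance L M s₀ + ((t : ℂ)) • (normalCovariance L M s₁ - normalCovariance L M s₀))
      (hubbardInteraction L M β U) ≠ 0)
    {N₆ S N₄ : ℝ}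
    (hN6 : ∀ t ∈ Set.Icc (0 : ℝ) 1, ∀ A : HubbardFieldIdx L M,
      ‖kernel ℂ (effAction ℂ (normalCovariance L M s₀ + ((t : ℂ)) • (normalCovariance L M s₁ - normalCovariance L M s₀))
        (hubbardInteraction L M β U)) 6 (Fin.snoc (Fin.snoc X (A.1, 1 - A.2) : Fin 5 → HubbardFieldIdx L M) A)‖ ≤ N₆)
    (hS : ∀ t ∈ Set.Icc (0 : ℝ) 1, ∀ i : Fin 4,
      ‖kernel ℂ (effAction ℂ (normalCovariance L M s₀ + ((t : ℂ)) • (normalCovariance L M s₁ - normalCovariance L M s₀))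
        (hubbardInteraction L M β U)) 2 ![(((X i).1, 1 - (X i).2) : HubbardFieldIdx L M), X i]‖ ≤ S)
    (hN4 : ∀ t ∈ Set.Icc (0 : ℝ) 1,
      ‖kernel ℂ (effAction ℂ (normalCovariance L M s₀ + ((t : ℂ)) • (normalCovariance L M s₁ - normalCovariance L M s₀))
        (hubbardInteraction L M β U)) 4 X‖ ≤ N₄) :
    ‖kernel ℂ (effAction ℂ (normalCovariance L M s₁) (hubbardInteraction L M β U)) 4 X -
        kernel ℂ (effAction ℂ (normalCovariance L M s₀) (hubbardInteraction L M β U)) 4 X‖ ≤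
      (30 * (2 * (L : ℝ) ^ 2 * ((2 * B₁ + 1) * (β * (L : ℝ) ^ 2)) * (2 * β / Λ)) * N₆ +
          8 * (4 * ((2 * B₁ + 1) * (β * (L : ℝ) ^ 2)) / Λ ^ 2) * S * N₄) * frameDist K₁ K₀ := by
  refine (covResp_norm_kernel_four_frameShift_sub_le hB hβ hΛ μ U K₀ K₁ hs₀ hs₁ X hZ hN6 hS hN4).trans (le_of_eq ?_)
  ring

end Summit.HubbardSuperconductivity.HubbardSuperconductivity.Theorems.EngineV8

end
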